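import Mathlib
import Summits.Ventures.PercRepro2.CrossAPrimePendantReduce

/-!
# The pendant-mark reduction, III: CONTRACTION — the coin-leaf mark `b` folds into `w` with its coin
(blind cell PercRepro2, p5 g37; S4 §2.4 (s) addendum 44)

Same setting as `CrossAPrimePendantReduce` (`b` with exactly `f = {b, w}` and the coin
`g = {a₂, b}`).  Keeping the `f`-open piece WHOLE instead of pinning `g` inside it, the same
bookkeeping gives `crossC(p; π)(o, b) ≥ β(1 − β)(1 − r)·crossC(p⁰⁰; π)(o, w) + β²·crossC(p[f ↦ 1]; π)(o, b)`
(**`crossC_pendant_contract_bound`**; the difference is `r(1 − β)²·E₀ + β(1 − β)(r(1 − r)·S₁ + r²·S₂)`).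
Under `p[f ↦ 1]` the mark `b` is identified with `w` and the coin `g` becomes a coin at `w`: the
second term is the constant functional of the CONTRACTED graph at the pair `(o, w)`, and `π` is an
admissible constant for it (`adm_pi_update_f1`: every `W` of `Adm` contains `a₂`, so `a₁ ↔ v` off
`W` does not see the coin, and `b` is then a leaf).  Hence (**`crossA'so_nonneg_of_pendant_contract`**)
the sign at `(o, b)` follows from two instances of the ADMISSIBLE-CONSTANT crux (`Adm`-form,
`CrossAPrimeA2Induction`) on graphs without the vertex `b`: the graph with `b` deleted and the graph
with `b` contracted into `w` — no mixed coin term is needed.  Own work; standard axioms.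
-/

namespace Summit.Ventures.PercRepro2

open LeafRowPendantRootSO CrossAPrimeA2Route CrossAPrimeSupport CrossAPrimeA2Induction
  CrossAPrimeA2VEdge CrossAPrimeIsolatedFlip CrossAPrimeMarkAtV CrossAPrimePendantMark
  CrossAPrimePendantReduce

namespace CrossAPrimePendantContract

section Algebra

variable {R : Type*} [Field R] [LinearOrder R] [IsStrictOrderedRing R]

/-- The contraction bound as pure algebra: the `f`-open piece is kept whole. -/
lemma contract_algebra {β r π Z0 x0 y0 xv0 yv0 Dv0 Z1 x1 y1 xv1 yv1 Dv1
    Zs xs ys xvs yvs Ds Zvs Zg xg xvg Zvg : R}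
    (hβ0 : 0 ≤ β) (hβ1 : β ≤ 1) (hr0 : 0 ≤ r) (hr1 : r ≤ 1)
    (hZs : 0 ≤ Zs) (hxs : 0 ≤ xs) (hxvs : 0 ≤ xvs) (hZg : 0 ≤ Zg) (hxg : 0 ≤ xg) (hxvg : 0 ≤ xvg)
    (hZgs : Zg ≤ Zs) (hZvg : Zvg ≤ π * Zg) (hZvs : Zvs ≤ π * Zs)
    (hZ0 : Z0 = Zs) (hx0 : x0 = xs) (hxv0 : xv0 = xvs) (hy0 : y0 = r * Zs) (hyv0 : yv0 = r * Zvs)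
    (hDv0 : Dv0 = r * xvs)
    (hZ1 : Z1 = r * Zg + (1 - r) * Zs) (hx1 : x1 = r * xg + (1 - r) * xs)
    (hy1 : y1 = r * Zg + (1 - r) * ys) (hxv1 : xv1 = r * xvg + (1 - r) * xvs)
    (hyv1 : yv1 = r * Zvg + (1 - r) * yvs) (hDv1 : Dv1 = r * xvg + (1 - r) * Ds) :
    β * (1 - β) * (1 - r) * (2 * Zs * Ds - ys * xvs + π * xs * ys - xs * yvs) +
        β ^ 2 * (2 * Z1 * Dv1 - y1 * xv1 + π * x1 * y1 - x1 * yv1) ≤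
      (1 - β) ^ 2 * (2 * Z0 * Dv0 - y0 * xv0 + π * x0 * y0 - x0 * yv0) +
        β * (1 - β) *
          ((2 * Z0 * Dv1 - y0 * xv1 + π * x0 * y1 - x0 * yv1) +
            (2 * Z1 * Dv0 - y1 * xv0 + π * x1 * y0 - x1 * yv0)) +
        β ^ 2 * (2 * Z1 * Dv1 - y1 * xv1 + π * x1 * y1 - x1 * yv1) := by
  rw [hZ0, hx0, hxv0, hy0, hyv0, hDv0, hZ1, hx1, hy1, hxv1, hyv1, hDv1]
  have hr' : 0 ≤ 1 - r := by linarith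
  have hβ' : 0 ≤ 1 - β := by linarith
  have hA : 0 ≤ π * Zs - Zvs := by linarith
  have hB : 0 ≤ π * Zg - Zvg := by linarith
  have hC : 0 ≤ Zs - Zg := by linarith
  have t1 : 0 ≤ r * (1 - β) ^ 2 * (Zs * xvs + xs * (π * Zs - Zvs)) :=
    mul_nonneg (mul_nonneg hr0 (sq_nonneg _)) (add_nonneg (mul_nonneg hZs hxvs) (mul_nonneg hxs hA))
  have t2 : 0 ≤ β * (1 - β) * (r * (1 - r)) *
      ((Zs - Zg) * xvs + xs * (π * Zs - Zvs) + 2 * Zs * xvg + xs * (π * Zg - Zvg)) := by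
    refine mul_nonneg (mul_nonneg (mul_nonneg hβ0 hβ') (mul_nonneg hr0 hr')) ?_
    have a1 : 0 ≤ (Zs - Zg) * xvs := mul_nonneg hC hxvs
    have a2 : 0 ≤ xs * (π * Zs - Zvs) := mul_nonneg hxs hA
    have a3 : 0 ≤ 2 * Zs * xvg := mul_nonneg (mul_nonneg (by norm_num) hZs) hxvg
    have a4 : 0 ≤ xs * (π * Zg - Zvg) := mul_nonneg hxs hB
    linarith
  have t3 : 0 ≤ β * (1 - β) * r ^ 2 *
      (Zs * xvg + xs * (π * Zg - Zvg) + Zg * xvs + xg * (π * Zs - Zvs)) := by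
    refine mul_nonneg (mul_nonneg (mul_nonneg hβ0 hβ') (sq_nonneg _)) ?_
    have a1 : 0 ≤ Zs * xvg := mul_nonneg hZs hxvg
    have a2 : 0 ≤ xs * (π * Zg - Zvg) := mul_nonneg hxs hB
    have a3 : 0 ≤ Zg * xvs := mul_nonneg hZg hxvs
    have a4 : 0 ≤ xg * (π * Zs - Zvs) := mul_nonneg hxg hA
    linarith
  linear_combination t1 + t2 + t3

end Algebra

section Adm

variable {V : Type*} {E : Type*} [Fintype E] [DecidableEq E] {R : Type*} [Field R]
  [LinearOrder R] [IsStrictOrderedRing R]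
variable {ends : E → Sym2 V}

omit [Fintype E] in
/-- Opening the leaf edge `f = {b, w}` at an isolated `b` does not change `a₁ ↔ v` off `W`. -/
lemma delConn_update_f_iff {f : E} {b w a₁ v : V} (hf : ends f = s(b, w)) (W : Set V)
    {ω : Config E} (hiso : ∀ e', b ∈ ends e' → ω e' = false) (hba₁ : a₁ ≠ b) (hbv : v ≠ b) :
    Function.update ω f true ∈ delConn ends W a₁ v ↔ ω ∈ delConn ends W a₁ v := by
  classical
  simp only [delConn, Set.mem_setOf_eq]
  by_cases hfW : f ∈ touches ends W
  · have : delConfig ends W (Function.update ω f true) = delConfig ends W ω := by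
      funext e
      by_cases he : e = f
      · subst he; simp only [delConfig, if_pos hfW]
      · simp only [delConfig, Function.update_of_ne he]
    rw [this]
  · have : delConfig ends W (Function.update ω f true) =
        Function.update (delConfig ends W ω) f true := by
      funext e
      by_cases he : e = f
      · subst he; simp only [delConfig, if_neg hfW, Function.update_self]
      · simp only [delConfig, Function.update_of_ne he]
    rw [this]
    have hf' : ends f = s(w, b) := by rw [hf, Sym2.eq_swap]
    refine conn_update_true_iff_of_isolated hf' ?_ hba₁ hbv
    intro e' he'
    simp only [delConfig]
    split_ifs
    · rfl
    · exact hiso e' he'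

/-- `π = P_p(a₁ ↔ v)` is admissible for the contracted graph `p[f ↦ 1]`: every `W` of `Adm`
contains `a₂`, so `a₁ ↔ v` off `W` does not see the coin `g`, and then `b` is a leaf at `w`. -/
lemma adm_pi_update_f1 (p : E → R) (hp : IsProbVec p) {f g : E} {a₁ a₂ v b w : V}
    (hf : ends f = s(b, w)) (hg : ends g = s(a₂, b)) (hb : ∀ e, b ∈ ends e → e = f ∨ e = g)
    (hfg : f ≠ g) (hba₁ : a₁ ≠ b) (hbv : v ≠ b) :
    Adm (Function.update p f 1) (prob p (connEvent ends a₁ v)) ends a₁ a₂ v := by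
  intro W hW _
  have ha₂W : a₂ ∈ W := hW (mem_cluster_self ends _ a₂)
  have hgW : g ∈ touches ends W := mem_touches_of_ends hg (Or.inl ha₂W)
  rw [← prob_update_zero_of_dependsOn' (p := Function.update p f 1) hgW (dependsOn_delConn W a₁ v),
    prob_g0f1_eq_g0f0 (ends := ends) p hb hfg _
      (fun ω hiso => delConn_update_f_iff hf W hiso hba₁ hbv)]
  have hq0 : IsProbVec (Function.update p f 0) := hp.update f le_rfl zero_le_one
  have hq00 : IsProbVec (Function.update (Function.update p f 0) g 0) :=
    hq0.update g le_rfl zero_le_one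
  calc prob (Function.update (Function.update p f 0) g 0) (delConn ends W a₁ v)
      ≤ prob (Function.update (Function.update p f 0) g 0) (connEvent ends a₁ v) :=
        prob_mono hq00 fun ω hω => conn_mono (delConfig_le W ω) hω
    _ ≤ prob (Function.update p f 0) (connEvent ends a₁ v) :=
        prob_update_zero_le _ hq0 g (isUpperSet_connEvent ends a₁ v)
    _ ≤ prob p (connEvent ends a₁ v) := prob_update_zero_le p hp f (isUpperSet_connEvent ends a₁ v)

end Adm

section Main

variable {V : Type*} {E : Type*} [Fintype E] [DecidableEq E] [Fintype V] [DecidableEq V]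
  {R : Type*} [Field R] [LinearOrder R] [IsStrictOrderedRing R]
variable {ends : E → Sym2 V}

omit [DecidableEq V] in
/-- **The contraction bound.**  `b` has exactly the edges `f = {b, w}` and `g = {a₂, b}`; then
`crossC(p; π)(o, b) ≥ β(1 − β)(1 − r)·crossC(p⁰⁰; π)(o, w) + β²·crossC(p[f ↦ 1]; π)(o, b)`, the
last term being the constant functional of the contracted graph (`b ≡ w`, the coin kept). -/
theorem crossC_pendant_contract_bound (p : E → R) (hp : IsProbVec p) {f g : E}
    {o a₁ a₂ v b w : V} (hf : ends f = s(b, w)) (hg : ends g = s(a₂, b))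
    (hb : ∀ e, b ∈ ends e → e = f ∨ e = g) (hfg : f ≠ g)
    (hba₁ : a₁ ≠ b) (hba₂ : a₂ ≠ b) (hbo : o ≠ b) (hbv : v ≠ b) (hbw : w ≠ b) :
    p f * (1 - p f) * (1 - p g) *
          crossC (Function.update (Function.update p f 0) g 0) (prob p (connEvent ends a₁ v))
            ends o a₁ a₂ v w +
        p f ^ 2 * crossC (Function.update p f 1) (prob p (connEvent ends a₁ v)) ends o a₁ a₂ v b ≤
      crossC p (prob p (connEvent ends a₁ v)) ends o a₁ a₂ v b := by
  classical
  rw [crossC_pin_quadratic p _ ends f o a₁ a₂ v b, ← crossC_eq_crossPatC]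
  set π := prob p (connEvent ends a₁ v) with hπ
  set Q := avoidAll ends a₂ {a₁} with hQ
  set oH := connEvent ends a₂ o
  set bH := connEvent ends a₂ b
  set wH := connEvent ends a₂ w
  set L := connEvent ends a₁ v
  set p00 := Function.update (Function.update p f 0) g 0 with hp00
  set p10 := Function.update (Function.update p f 1) g 0 with hp10
  set p11 := Function.update (Function.update p f 1) g 1 with hp11
  have hq00 : IsProbVec p00 := (hp.update f le_rfl zero_le_one).update g le_rfl zero_le_one
  have hq11 : IsProbVec p11 := (hp.update f zero_le_one le_rfl).update g zero_le_one le_rfl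
  have hβ0 : 0 ≤ p f := hp.nonneg f
  have hβ1 : p f ≤ 1 := hp.le_one f
  have hr0 : 0 ≤ p g := hp.nonneg g
  have hr1 : p g ≤ 1 := hp.le_one g
  -- flip invariance at the isolated `b`
  have flipg : ∀ ω : Config E, (∀ e, b ∈ ends e → ω e = false) →
      ((Function.update ω g true ∈ Q ↔ ω ∈ Q) ∧ (Function.update ω g true ∈ oH ↔ ω ∈ oH) ∧
        (Function.update ω g true ∈ L ↔ ω ∈ L) ∧ (Function.update ω g true ∈ wH ↔ ω ∈ wH)) :=
    fun ω hiso => flip4_iff_of_isolated (o := o) (v := v) (w := w) hg hiso hba₁ hba₂ hbo hbv hbw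
  have flipf : ∀ ω : Config E, (∀ e, b ∈ ends e → ω e = false) →
      ((Function.update ω f true ∈ Q ↔ ω ∈ Q) ∧ (Function.update ω f true ∈ oH ↔ ω ∈ oH) ∧
        (Function.update ω f true ∈ L ↔ ω ∈ L) ∧ (Function.update ω f true ∈ wH ↔ ω ∈ wH)) :=
    fun ω hiso => flipf_iff_of_isolated (o := o) (v := v) (a₂ := a₂) hf hiso hba₁ hba₂ hbo hbv hbw
  -- the masses of `p[f ↦ 0]`: the independent mark, and the `b`-free masses are those of `p⁰⁰`
  have hy0 : prob (Function.update p f 0) (Q ∩ bH) = p g * prob (Function.update p f 0) Q := by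
    have := prob_bH_eq (ends := ends) p hf hg hb hfg hba₁ hba₂ hbw hbv Set.univ (fun ω _ => by simp)
    simpa only [Set.univ_inter, Set.inter_univ] using this
  have hyv0 : prob (Function.update p f 0) (Q ∩ (L ∩ bH)) =
      p g * prob (Function.update p f 0) (Q ∩ L) :=
    prob_bH_eq (ends := ends) p hf hg hb hfg hba₁ hba₂ hbw hbv L (fun ω hiso => (flipg ω hiso).2.2.1)
  have hDv0 : prob (Function.update p f 0) (Q ∩ (L ∩ (oH ∩ bH))) =
      p g * prob (Function.update p f 0) (Q ∩ (L ∩ oH)) := by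
    have := prob_bH_eq (ends := ends) p hf hg hb hfg hba₁ hba₂ hbw hbv (L ∩ oH)
      (fun ω hiso => by
        simp only [Set.mem_inter_iff, (flipg ω hiso).2.1, (flipg ω hiso).2.2.1])
    rwa [Set.inter_assoc L oH bH] at this
  have hZ0 : prob (Function.update p f 0) Q = prob p00 Q :=
    prob_f0_eq_f0g0 (ends := ends) p hb hfg Q (fun ω hiso => (flipg ω hiso).1)
  have hx0 : prob (Function.update p f 0) (Q ∩ oH) = prob p00 (Q ∩ oH) :=
    prob_f0_eq_f0g0 (ends := ends) p hb hfg (Q ∩ oH) (fun ω hiso => by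
      simp only [Set.mem_inter_iff, (flipg ω hiso).1, (flipg ω hiso).2.1])
  have hxv0 : prob (Function.update p f 0) (Q ∩ (L ∩ oH)) = prob p00 (Q ∩ (L ∩ oH)) :=
    prob_f0_eq_f0g0 (ends := ends) p hb hfg (Q ∩ (L ∩ oH)) (fun ω hiso => by
      simp only [Set.mem_inter_iff, (flipg ω hiso).1, (flipg ω hiso).2.1, (flipg ω hiso).2.2.1])
  have hZv0 : prob (Function.update p f 0) (Q ∩ L) = prob p00 (Q ∩ L) :=
    prob_f0_eq_f0g0 (ends := ends) p hb hfg (Q ∩ L) (fun ω hiso => by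
      simp only [Set.mem_inter_iff, (flipg ω hiso).1, (flipg ω hiso).2.2.1])
  -- the masses of `p[f ↦ 1]` by the pinning of `g`
  have pin1 : ∀ X : Set (Config E), prob (Function.update p f 1) X =
      p g * prob p11 X + (1 - p g) * prob p10 X := by
    intro X
    have := prob_eq_pin (Function.update p f 1) X g
    rwa [Function.update_of_ne hfg.symm] at this
  -- the masses of `p¹⁰`: `b ↔ w` on the support, then `b` invisible
  have m10 : ∀ A : Set (Config E), (∀ ω : Config E, (∀ e, b ∈ ends e → ω e = false) →
      (Function.update ω f true ∈ A ↔ ω ∈ A)) →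
      prob p10 A = prob p00 A :=
    fun A hA => prob_g0f1_eq_g0f0 (ends := ends) p hb hfg A hA
  have hZ10 : prob p10 Q = prob p00 Q := m10 Q (fun ω hiso => (flipf ω hiso).1)
  have hx10 : prob p10 (Q ∩ oH) = prob p00 (Q ∩ oH) := m10 (Q ∩ oH) (fun ω hiso => by
    simp only [Set.mem_inter_iff, (flipf ω hiso).1, (flipf ω hiso).2.1])
  have hxv10 : prob p10 (Q ∩ (L ∩ oH)) = prob p00 (Q ∩ (L ∩ oH)) :=
    m10 (Q ∩ (L ∩ oH)) (fun ω hiso => by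
      simp only [Set.mem_inter_iff, (flipf ω hiso).1, (flipf ω hiso).2.1, (flipf ω hiso).2.2.1])
  have hy10 : prob p10 (Q ∩ bH) = prob p00 (Q ∩ wH) := by
    rw [prob_f1g0_bH_eq_wH (ends := ends) p hf hfg Q]
    exact m10 (Q ∩ wH) (fun ω hiso => by
      simp only [Set.mem_inter_iff, (flipf ω hiso).1, (flipf ω hiso).2.2.2])
  have hyv10 : prob p10 (Q ∩ (L ∩ bH)) = prob p00 (Q ∩ (L ∩ wH)) := by
    rw [← Set.inter_assoc, prob_f1g0_bH_eq_wH (ends := ends) p hf hfg (Q ∩ L), Set.inter_assoc]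
    exact m10 (Q ∩ (L ∩ wH)) (fun ω hiso => by
      simp only [Set.mem_inter_iff, (flipf ω hiso).1, (flipf ω hiso).2.2.1, (flipf ω hiso).2.2.2])
  have hDv10 : prob p10 (Q ∩ (L ∩ (oH ∩ bH))) = prob p00 (Q ∩ (L ∩ (oH ∩ wH))) := by
    rw [← Set.inter_assoc, ← Set.inter_assoc, prob_f1g0_bH_eq_wH (ends := ends) p hf hfg (Q ∩ L ∩ oH),
      Set.inter_assoc, Set.inter_assoc]
    exact m10 (Q ∩ (L ∩ (oH ∩ wH))) (fun ω hiso => by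
      simp only [Set.mem_inter_iff, (flipf ω hiso).1, (flipf ω hiso).2.1, (flipf ω hiso).2.2.1,
        (flipf ω hiso).2.2.2])
  -- the masses of `p¹¹`: `b ∈ K` surely
  have hy11 : prob p11 (Q ∩ bH) = prob p11 Q := prob_f1g1_bH (ends := ends) p hg Q
  have hyv11 : prob p11 (Q ∩ (L ∩ bH)) = prob p11 (Q ∩ L) := by
    rw [← Set.inter_assoc]; exact prob_f1g1_bH (ends := ends) p hg (Q ∩ L)
  have hDv11 : prob p11 (Q ∩ (L ∩ (oH ∩ bH))) = prob p11 (Q ∩ (L ∩ oH)) := by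
    rw [← Set.inter_assoc, ← Set.inter_assoc]
    rw [prob_f1g1_bH (ends := ends) p hg (Q ∩ L ∩ oH), Set.inter_assoc]
  -- the side facts
  have hZgs : prob p11 Q ≤ prob p00 Q := by
    rw [← hZ10]
    exact prob_update_one_le_update_zero (Function.update p f 1) (hp.update f zero_le_one le_rfl) g
      (fun ω ω' h hω y hy hc => hω y hy (conn_mono h hc))
  have hZvg : prob p11 (Q ∩ L) ≤ π * prob p11 Q := by
    have key := prob_Q_vL_le_mul hq11
      (adm_pi_f1g1 (ends := ends) (a₁ := a₁) (v := v) p hp hf hg) (Set.univ : Set (Set V))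
    have cu : clusterInEvent ends a₂ (Set.univ : Set (Set V)) = Set.univ := by
      ext ω; simp [clusterInEvent]
    rw [cu, Set.univ_inter, Set.univ_inter, Set.inter_comm] at key
    exact key
  have hZvs : prob p00 (Q ∩ L) ≤ π * prob p00 Q := by
    have key := prob_Q_vL_le_mul hq00 (adm_pi_f0g0 (ends := ends) p hp f g a₁ a₂ v)
      (Set.univ : Set (Set V))
    have cu : clusterInEvent ends a₂ (Set.univ : Set (Set V)) = Set.univ := by
      ext ω; simp [clusterInEvent]
    rw [cu, Set.univ_inter, Set.univ_inter, Set.inter_comm] at key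
    exact key
  -- assemble
  unfold crossC crossPatC
  rw [pin1 Q, pin1 (Q ∩ (L ∩ (oH ∩ bH))), pin1 (Q ∩ bH), pin1 (Q ∩ (L ∩ oH)), pin1 (Q ∩ oH),
    pin1 (Q ∩ (L ∩ bH))]
  rw [hy0, hyv0, hDv0, hZ0, hx0, hxv0, hZv0, hZ10, hx10, hxv10, hy10, hyv10, hDv10, hy11, hyv11,
    hDv11]
  exact contract_algebra hβ0 hβ1 hr0 hr1 (prob_nonneg hq00 _) (prob_nonneg hq00 _)
    (prob_nonneg hq00 _) (prob_nonneg hq11 _) (prob_nonneg hq11 _) (prob_nonneg hq11 _)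
    hZgs hZvg hZvs rfl rfl rfl rfl rfl rfl rfl rfl rfl rfl rfl rfl

omit [DecidableEq V] in
/-- **The contraction rule.**  The sign of `crossA′so` at `(o, b)` follows from the admissible-constant
crux at `(o, w)` on the graph with `b` deleted (`p⁰⁰`) and on the graph with `b` contracted into
`w` (`p[f ↦ 1]`, where `b ∈ K ⟺ w ∈ K`), both at the constant `π = P_p(a₁ ↔ v)` (admissible for
both: `adm_pi_f0g0`, `adm_pi_update_f1`). -/
theorem crossA'so_nonneg_of_pendant_contract (p : E → R) (hp : IsProbVec p) {f g : E}
    {o a₁ a₂ v b w : V} (hf : ends f = s(b, w)) (hg : ends g = s(a₂, b))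
    (hb : ∀ e, b ∈ ends e → e = f ∨ e = g) (hfg : f ≠ g)
    (hba₁ : a₁ ≠ b) (hba₂ : a₂ ≠ b) (hbo : o ≠ b) (hbv : v ≠ b) (hbw : w ≠ b)
    (hdel : 0 ≤ crossC (Function.update (Function.update p f 0) g 0)
      (prob p (connEvent ends a₁ v)) ends o a₁ a₂ v w)
    (hcon : 0 ≤ crossC (Function.update p f 1) (prob p (connEvent ends a₁ v)) ends o a₁ a₂ v b) :
    0 ≤ crossA'so p ends o a₁ a₂ v b := by
  rw [crossA'so_eq_crossC]
  refine le_trans ?_ (crossC_pendant_contract_bound (ends := ends) p hp hf hg hb hfg hba₁ hba₂ hbo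
    hbv hbw)
  have hβ0 : 0 ≤ p f := hp.nonneg f
  have hβ1 : 0 ≤ 1 - p f := by linarith [hp.le_one f]
  have hr1 : 0 ≤ 1 - p g := by linarith [hp.le_one g]
  have t1 := mul_nonneg (mul_nonneg (mul_nonneg hβ0 hβ1) hr1) hdel
  have t2 := mul_nonneg (sq_nonneg (p f)) hcon
  linarith

end Main

end CrossAPrimePendantContract

end Summit.Ventures.PercRepro2
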